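import Summits.ResolutionOfSingularities.ResolutionOfSingularities.Theorems.MarkedTransferCampaignW12SandwichRho
import Summits.ResolutionOfSingularities.ResolutionOfSingularities.Theorems.MarkedTransferCampaignW12SandwichEq59Obstruction
import Summits.ResolutionOfSingularities.ResolutionOfSingularities.Theorems.MarkedTransferCampaignG1PnegaPowerWitness
import Mathlib.RingTheory.Filtration
import Mathlib.Algebra.Group.Pointwise.Set.ListOfFn
import Mathlib.Algebra.Algebra.Operations
import HarnessLib

/-!
# [OURS · L1 G1 ℘nega-INTERFACE · obstruction kernel] The Frobenius-sandwich negative pieces (W1.2 `SW`, the module `SWρ`,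
# the power witness `PW`) are NEVER antitone below zero at a Noetherian local placement of the regime
# (`℘(E,j) ⊆ 𝔪^j`, `℘(E,m) ≠ 0`): Lem 5.9 (1) / the field `antitone_nonpos` fails for the whole sandwich family

LADDER-RESOLUTION rung L (rescue), cell `res-hironaka`, group G1 (`℘nega`), ℘nega-INTERFACE scoring (instrument
`Campaign.PnegaInterfaceV3` p487629 / V4 rev 0.7 — `antitone_nonpos` STAYS A FIELD, res-D-plan-1 ruling 2026-08-27T03:44:20Z (1);
scorer res-adj-1). D-lane draft by res-D-pv-040 (HOME/D/res-D-pv-040/), companion of `PnegaSandwichA1Calibration.draft.lean`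
(1b103d54d62d6c27): there the failure was COMPUTED at the affine-line placement; here it is proved at EVERY placement of the regime.
NO new definition; tree objects only (`Campaign.sandwichPNega` p470322, `Campaign.sandwichPNegaRho` p488714,
`Campaign.PowerWitness.negPiece` p492701).

## The theorem (§3) and its mechanism (§1–§2)

Let `O` be a commutative ring of characteristic `p`, `𝔪 = (u_1,…,u_n)` a finitely generated ideal with `⋂_N 𝔪^N = 0` (e.g. the
maximal ideal of a Noetherian local ring — Krull), `P j = ℘(E,j) ⊆ 𝔪^j` for `j ≥ 1` (the order condition of a standard exponent along
its singular locus), `m ≥ 1` with `℘(E,m) ≠ 0`. Then for every level `e`: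

  `¬ (∀ b > m, ℘nega_sw(E,−m) ⊆ ℘nega_sw(E,−b))`   (`sandwichPNega_not_le_of_krull`; hence `not_monotone_sandwichPNega_of_krull`,
  `not_Lem5_9_1_frobeniusRange_of_krull` = the typed Lem 5.9 (1) READ AT BASE `ρ^e(O)` refuted, and the literal V3/V4-field shape
  `not_antitone_nonpos_sandwich_of_krull`),

and the same for the module `SWρ` (as sets, `sandwichPNegaRho_not_subset_of_krull`) and, over a reduced `O`, for `PW = ρ^e(SW)`
(`negPiece_not_le_of_krull`); Noetherian-local corollaries `sandwichPNega_not_le_of_isLocalRing` /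
`sandwichPNegaRho_negPiece_not_subset_of_isLocalRing` ([IsNoetherianRing O] [IsLocalRing O], 𝔪 = maximalIdeal, Krull from Mathlib).

MECHANISM (§1 pigeonhole + §2 range bound): Def 5.1 sums `D(m,a,d)` over `d·m ≥ |a|` only; relative operators are `ρ^e(O)`-linear,
so a summand whose source `℘(E,dm) ⊆ 𝔪^{dm}` lies in a Frobenius span `ρ^e(𝔪^j)·O` stays there; and `𝔪^N ⊆ ρ^e(𝔪^j)·O` as soon as
`N ≥ j·p^e + n·(p^e − 1)` (pigeonhole on exponents, `pow_le_map_iterateFrobenius_pow`). Hence `℘nega_sw(E,−b) ⊆ ρ^e(𝔪^{j(b)})·O ⊆ 𝔪^{j(b)}`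
with `j(b) → ∞`, while `℘(E,m) ⊆ ℘nega_sw(E,−m)` (`∂ = id`). Monotonicity would put `℘(E,m)` inside `⋂_N 𝔪^N = 0`.
READING (no verdict on print): the printed engine of Lem 5.9 (1) is the d-climb of Lem 5.6 / Rem 5.7 through HIGH-ORDER ABSOLUTE
operators; re-basing Def 5.1 on `Diff_{O/ρ^e(O)}` removes exactly that engine. For the 08:00Z table: SW · SWρ · PW × F8⁻ = ✗ in the
whole regime, not only at `𝔸¹`.

CARRIER NOTE (res-L1-type-o2 g6). KERNEL by res-D-pv-040 (HOME draft `D/res-D-pv-040/PnegaSandwichAntitoneObstruction.draft.lean` sha16 4f2670b2f74880a0, DELIVERED #2 2026-08-27T04:01:11Z), carried summit-side VERBATIM (terms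
byte-identical; this note added). [OURS · L1 G1] replaces the role of: nothing printed — a scoring kernel; NOT a statement of the manuscript.

HONEST FRAMING. Nothing here is a statement of H. Hironaka's manuscript *Resolution of singularities in positive characteristics*
(2017-03-23, [Hironaka2017], lit key `paper:url-3343fd9e678b`); Def 5.1 / Eq. (36) and Lem 5.9 enter only as SHAPES re-based on
`ρ^e(O)` (OURS rescue candidates), CANDIDATES [claim: Hironaka2017, status: under-review]. AI typing/proving is weaker than expert
review; nothing here is progress on resolution of singularities in positive characteristic; no claim beyond the kernel.
-/

noncomputable section

set_option linter.dupNamespace false -- mandated namespace of this single-conjunct summit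

namespace Summit.ResolutionOfSingularities.ResolutionOfSingularities.Theorems.Campaign.W12

open Literature.AlgebraicGeometry.Resolution
open Literature.AlgebraicGeometry.Hironaka2017
open Summit.ResolutionOfSingularities.ResolutionOfSingularities.Theorems.Campaign
open scoped Pointwise

universe v

variable {O : Type v} [CommRing O] (p : ℕ) [Fact p.Prime] [CharP O p]

/-! ## §1 Pigeonhole: high powers of a finitely generated ideal lie in Frobenius spans -/

omit [Fact p.Prime] [CharP O p] in
/-- A product of `N` generators, regrouped: `∏_k u_{g(k)} = ∏_j u_j^{#g⁻¹(j)}`. [folklore] -/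
theorem prod_ofFn_generators_eq {n N : ℕ} (u : Fin n → O) (g : Fin N → Fin n) :
    (List.ofFn fun k => u (g k)).prod = ∏ j : Fin n, u j ^ (Finset.univ.filter fun k => g k = j).card := by
  rw [List.prod_ofFn, ← Finset.prod_fiberwise' Finset.univ g u]
  exact Finset.prod_congr rfl fun j _ => Finset.prod_const _

omit [Fact p.Prime] [CharP O p] in
/-- The fibre cardinalities of `g : Fin N → Fin n` add up to `N`. [folklore] -/
theorem sum_card_fiber_eq {n N : ℕ} (g : Fin N → Fin n) :
    ∑ j : Fin n, (Finset.univ.filter fun k => g k = j).card = N := by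
  classical
  rw [← Finset.card_eq_sum_card_fiberwise (f := g) (s := Finset.univ) (t := Finset.univ)
    fun _ _ => Finset.mem_coe.mpr (Finset.mem_univ _)]
  exact Finset.card_fin N

omit [Fact p.Prime] [CharP O p] in
/-- A monomial `∏_i u_i^{t_i}` in generators of `𝔪` lies in `𝔪^{Σ t_i}`. [folklore] -/
theorem prod_pow_mem_pow_sum {n : ℕ} (u : Fin n → O) (t : Fin n → ℕ) :
    ∏ i : Fin n, u i ^ t i ∈ Ideal.span (Set.range u) ^ ∑ i : Fin n, t i := by
  rw [← Finset.prod_pow_eq_pow_sum]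
  exact Ideal.prod_mem_prod fun i _ => Ideal.pow_mem_pow (Ideal.subset_span (Set.mem_range_self i)) _

/-- **Pigeonhole on exponents.** For an ideal `𝔪 = (u_1,…,u_n)` of a ring of characteristic `p` and `q = p^e`: a monomial
`u^c` of degree `|c| = N ≥ j·q + n·(q−1)` factors as `(∏ u_i^{⌊c_i/q⌋})^q · u^{c mod q}` with `Σ ⌊c_i/q⌋ ≥ j`, so
`𝔪^N ⊆ ρ^e(𝔪^j)·O = (𝔪^j).map ρ^e`. [folklore] -/
theorem pow_le_map_iterateFrobenius_pow (e : ℕ) {n : ℕ} (u : Fin n → O) (j N : ℕ)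
    (hN : j * p ^ e + n * (p ^ e - 1) ≤ N) :
    Ideal.span (Set.range u) ^ N ≤ (Ideal.span (Set.range u) ^ j).map (iterateFrobenius O p e) := by
  classical
  have hq : 0 < p ^ e := pow_pos (Fact.out : p.Prime).pos e
  have hpow : Ideal.span (Set.range u) ^ N = Ideal.span ((Set.range u) ^ N) := by
    show Submodule.span O (Set.range u) ^ N = Submodule.span O ((Set.range u) ^ N)
    rw [Submodule.span_pow]
  rw [hpow, Ideal.span_le]
  intro x hx
  obtain ⟨f, rfl⟩ := Set.mem_pow.mp hx
  choose g hg using fun k : Fin N => (f k).2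
  have hlist : (List.ofFn fun k => (f k : O)) = List.ofFn fun k => u (g k) := by
    congr 1
    funext k
    exact (hg k).symm
  rw [SetLike.mem_coe, hlist, prod_ofFn_generators_eq u g]
  set c : Fin n → ℕ := fun j => (Finset.univ.filter fun k => g k = j).card with hc
  have hsum : ∑ i, c i = N := sum_card_fiber_eq g
  -- split every exponent `c_i = q·(c_i / q) + c_i % q`
  have hsplit : ∏ i, u i ^ c i = (∏ i, u i ^ (c i / p ^ e)) ^ p ^ e * ∏ i, u i ^ (c i % p ^ e) := by
    rw [← Finset.prod_pow, ← Finset.prod_mul_distrib]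
    refine Finset.prod_congr rfl fun i _ => ?_
    rw [← pow_mul, ← pow_add, Nat.div_add_mod']
  -- the exponent count: `j ≤ Σ c_i / q`
  have h1 : ∑ i, c i = p ^ e * ∑ i, (c i / p ^ e) + ∑ i, c i % p ^ e := by
    rw [Finset.mul_sum, ← Finset.sum_add_distrib]
    exact Finset.sum_congr rfl fun i _ => (Nat.div_add_mod (c i) (p ^ e)).symm
  have h2 : ∑ i, c i % p ^ e ≤ n * (p ^ e - 1) := by
    calc ∑ i, c i % p ^ e ≤ ∑ _i : Fin n, (p ^ e - 1) :=
          Finset.sum_le_sum fun i _ => Nat.le_sub_one_of_lt (Nat.mod_lt _ hq)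
      _ = n * (p ^ e - 1) := by
          rw [Finset.sum_const, Finset.card_univ, Fintype.card_fin, smul_eq_mul]
  have h3 : p ^ e * j ≤ p ^ e * ∑ i, (c i / p ^ e) := by
    have : j * p ^ e = p ^ e * j := mul_comm _ _
    omega
  have h4 : j ≤ ∑ i, (c i / p ^ e) := Nat.le_of_mul_le_mul_left h3 hq
  -- assemble
  rw [hsplit]
  refine Ideal.mul_mem_right _ _ ?_
  rw [← iterateFrobenius_def]
  refine Ideal.mem_map_of_mem _ ?_
  exact Ideal.pow_le_pow_right h4 (prod_pow_mem_pow_sum u _)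

/-! ## §2 The range-restricted Frobenius bound for the sandwich (only the summands Eq. (36) sums) -/

/-- If every source piece `℘posi(E,dm)` that Eq. (36) sums in degree `−a` (`d ≥ 1`, `d·m ≥ a`) lies in the Frobenius extension
`J.map ρ^e`, then so does `℘nega_sw(E,−a)` (relative operators are `ρ^e(O)`-linear, tree `Campaign.W12.diffIdeal_le_span`). [folklore] -/
theorem sandwichPNega_le_map_of_range (e : ℕ) (J : Ideal O) {P : ℕ → Ideal O} {m a : ℕ}
    (hP : ∀ d : ℕ, 0 < d → a ≤ d * m → S05NegativePart.pPosi P (d * m) ≤ J.map (iterateFrobenius O p e)) :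
    sandwichPNega p e P m a ≤ J.map (iterateFrobenius O p e) := by
  unfold sandwichPNega S05NegativePart.pNega S05NegativePart.pTildeNeg
  refine iSup₂_le fun d hd => ?_
  unfold S05NegativePart.DD
  rw [map_iterateFrobenius_eq_span]
  refine diffIdeal_le_span e _ (image_subset_range_iterateFrobenius e J) ?_
  rw [← map_iterateFrobenius_eq_span]
  rcases le_or_gt d 0 with hd0 | hd0
  · have h0 : (d * (m : ℤ)).toNat = 0 :=
      Int.toNat_eq_zero.mpr (mul_nonpos_of_nonpos_of_nonneg hd0 (by positivity))
    rw [h0]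
    simp [S05NegativePart.pPosi]
  · obtain ⟨k, rfl⟩ := Int.eq_ofNat_of_zero_le hd0.le
    have hk : ((k : ℤ) * (m : ℤ)).toNat = k * m := by
      rw [← Nat.cast_mul, Int.toNat_natCast]
    rw [hk]
    have hkpos : 0 < k := by exact_mod_cast hd0
    have hakm : a ≤ k * m := by
      rw [Nat.abs_cast] at hd
      exact_mod_cast hd
    exact hP k hkpos hakm

/-- **The squeeze on one negative piece.** Under the order condition `℘(E,k) ⊆ 𝔪^k` (`k ≥ 1`), `𝔪 = (u_1,…,u_n)`: for every
`b ≥ j·p^e + n·(p^e−1)`, `℘nega_sw(E,−b) ⊆ (𝔪^j).map ρ^e ⊆ 𝔪^j`. [folklore] -/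
theorem sandwichPNega_le_pow_of_order (e : ℕ) {n : ℕ} (u : Fin n → O) {P : ℕ → Ideal O}
    (hP : ∀ k, 0 < k → P k ≤ Ideal.span (Set.range u) ^ k) (m : ℕ) {j b : ℕ}
    (hb : j * p ^ e + n * (p ^ e - 1) ≤ b) :
    sandwichPNega p e P m b ≤ Ideal.span (Set.range u) ^ j := by
  refine (sandwichPNega_le_map_of_range p e (Ideal.span (Set.range u) ^ j) fun d hd hdb => ?_).trans
    (map_iterateFrobenius_le e _)
  rcases Nat.eq_zero_or_pos m with rfl | hm
  · simp [S05NegativePart.pPosi]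
  · have hdm : d * m ≠ 0 := Nat.mul_ne_zero hd.ne' hm.ne'
    simp only [S05NegativePart.pPosi, if_neg hdm]
    exact (hP (d * m) (Nat.pos_of_ne_zero hdm)).trans
      (pow_le_map_iterateFrobenius_pow p e u j (d * m) (hb.trans hdb))

/-! ## §3 The obstruction: no member of the sandwich family is antitone below zero -/

/-- **OBSTRUCTION (SW × F8⁻ / Lem 5.9 (1) at base `ρ^e(O)`), sharpest form.** `O` of characteristic `p`, `𝔪 = (u_1,…,u_n)` with
`⋂_N 𝔪^N = 0`, order condition `℘(E,k) ⊆ 𝔪^k` (`k ≥ 1`), `m ≥ 1`, `℘(E,m) ≠ 0`: it is NOT the case that `℘nega_sw(E,−m) ⊆ ℘nega_sw(E,−b)`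
for all `b > m` — for every level `e`. (Else `℘(E,m) ⊆ ℘nega_sw(−m) ⊆ ℘nega_sw(−b) ⊆ 𝔪^{j(b)}` for all `b`, `j(b) → ∞`.) [folklore] -/
theorem sandwichPNega_not_le_of_krull (e : ℕ) {n : ℕ} (u : Fin n → O)
    (hKrull : ⨅ N : ℕ, Ideal.span (Set.range u) ^ N = ⊥)
    {P : ℕ → Ideal O} (hP : ∀ k, 0 < k → P k ≤ Ideal.span (Set.range u) ^ k)
    {m : ℕ} (hm : 0 < m) (hPm : P m ≠ ⊥) :
    ¬ ∀ b : ℕ, m < b → sandwichPNega p e P m m ≤ sandwichPNega p e P m b := by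
  intro hmono
  apply hPm
  rw [eq_bot_iff]
  intro f hf
  rw [← hKrull, Submodule.mem_iInf]
  intro N
  have h1 : f ∈ sandwichPNega p e P m m :=
    le_sandwichPNega p e P (m := m) (a := m) (d := 1) (by omega) (by omega) (by rw [one_mul]; exact hf)
  have h2 : f ∈ sandwichPNega p e P m (N * p ^ e + n * (p ^ e - 1) + m + 1) := hmono _ (by omega) h1
  exact sandwichPNega_le_pow_of_order p e u hP m (j := N) (by omega) h2

/-- **SW × F8⁻ = ✗ in the regime** (monotone form `a ≤ b ⇒ ℘nega_sw(−a) ⊆ ℘nega_sw(−b)` refuted). [folklore] -/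
theorem not_monotone_sandwichPNega_of_krull (e : ℕ) {n : ℕ} (u : Fin n → O)
    (hKrull : ⨅ N : ℕ, Ideal.span (Set.range u) ^ N = ⊥)
    {P : ℕ → Ideal O} (hP : ∀ k, 0 < k → P k ≤ Ideal.span (Set.range u) ^ k)
    {m : ℕ} (hm : 0 < m) (hPm : P m ≠ ⊥) :
    ¬ ∀ a b : ℕ, a ≤ b → sandwichPNega p e P m a ≤ sandwichPNega p e P m b :=
  fun h => sandwichPNega_not_le_of_krull p e u hKrull hP hm hPm fun b hb => h m b hb.le

/-- **Lem 5.9 (1) READ AT BASE `ρ^e(O)` FAILS in the regime** (the typed `S05NegativePart.Lem5_9_1`, p.28 L19–L20, instantiated at the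
sandwich base — the premise `h59` of res-type-087's `PowerWitness.negPiece_antitone_of_Lem5_9_1`; NOT the printed base-`K` statement,
whose `Lem5_9_1_ctx_holds` stands). [folklore] -/
theorem not_Lem5_9_1_frobeniusRange_of_krull (e : ℕ) {n : ℕ} (u : Fin n → O)
    (hKrull : ⨅ N : ℕ, Ideal.span (Set.range u) ^ N = ⊥)
    {P : ℕ → Ideal O} (hP : ∀ k, 0 < k → P k ≤ Ideal.span (Set.range u) ^ k)
    {m : ℕ} (hm : 0 < m) (hPm : P m ≠ ⊥) :
    ¬ S05NegativePart.Lem5_9_1 (↥(iterateFrobenius O p e).range) P m :=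
  fun h59 => sandwichPNega_not_le_of_krull p e u hKrull hP hm hPm fun b hb => h59 m b hm hb

/-- **SW × F8⁻ = ✗ in the LITERAL shape of `Campaign.PnegaInterfaceV3.antitone_nonpos`** (`i ≤ j ≤ 0 ⇒ tilde P j ≤ tilde P i`, with
`tilde P i := Campaign.sandwichPTildeNeg p e P m (−i)`), in the regime. [folklore] -/
theorem not_antitone_nonpos_sandwich_of_krull (e : ℕ) {n : ℕ} (u : Fin n → O)
    (hKrull : ⨅ N : ℕ, Ideal.span (Set.range u) ^ N = ⊥)
    {P : ℕ → Ideal O} (hP : ∀ k, 0 < k → P k ≤ Ideal.span (Set.range u) ^ k)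
    {m : ℕ} (hm : 0 < m) (hPm : P m ≠ ⊥) :
    ¬ ∀ i j : ℤ, i ≤ j → j ≤ 0 → sandwichPTildeNeg p e P m (-j) ≤ sandwichPTildeNeg p e P m (-i) := by
  intro h
  refine sandwichPNega_not_le_of_krull p e u hKrull hP hm hPm fun b hb => ?_
  have := h (-(b : ℤ)) (-(m : ℤ)) (by omega) (by omega)
  rw [neg_neg, neg_neg] at this
  exact this

/-- Elements of `℘(E,dm)` are elements of the MODULE `℘nega_swρ(E,−a)` (`a ≤ dm ≠ 0`): the value of the order-`0` relative
operator `id`. [folklore] -/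
theorem subset_sandwichPNegaRho (e : ℕ) (P : ℕ → Ideal O) {m a d : ℕ} (had : a ≤ d * m) (hdm : d * m ≠ 0) :
    (P (d * m) : Set O) ⊆ (sandwichPNegaRho p e P m a : Set O) := by
  intro f hf
  have hdm' : |(a : ℤ)| ≤ (d : ℤ) * m := by
    rw [Nat.abs_cast]; exact_mod_cast had
  show f ∈ sandwichPNegaRho p e P m a
  unfold sandwichPNegaRho sandwichPTildeNegRho
  refine (le_iSup₂ (f := fun (d : ℤ) (_ : |(a : ℤ)| ≤ d * m) => sandwichDDRho p e P m a d) (d : ℤ) hdm') ?_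
  unfold sandwichDDRho
  refine Submodule.subset_span ⟨LinearMap.id, isDiffOpLE_id.of_le (Nat.zero_le _), f, ?_, rfl⟩
  have h1 : ((d : ℤ) * m).toNat = d * m := by
    rw [← Nat.cast_mul, Int.toNat_natCast]
  rw [h1]
  simpa [S05NegativePart.pPosi, hdm] using hf

/-- **OBSTRUCTION, SWρ form** (the `ρ^e(O)`-module variant p488714, as sets): under the same hypotheses `℘nega_swρ(E,−m) ⊄ ℘nega_swρ(E,−b)`
for some `b > m`; in particular the module pieces are not monotone / not `antitone_nonpos`. [folklore] -/
theorem sandwichPNegaRho_not_subset_of_krull (e : ℕ) {n : ℕ} (u : Fin n → O)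
    (hKrull : ⨅ N : ℕ, Ideal.span (Set.range u) ^ N = ⊥)
    {P : ℕ → Ideal O} (hP : ∀ k, 0 < k → P k ≤ Ideal.span (Set.range u) ^ k)
    {m : ℕ} (hm : 0 < m) (hPm : P m ≠ ⊥) :
    ¬ ∀ b : ℕ, m < b → (sandwichPNegaRho p e P m m : Set O) ⊆ (sandwichPNegaRho p e P m b : Set O) := by
  intro hmono
  apply hPm
  rw [eq_bot_iff]
  intro f hf
  rw [← hKrull, Submodule.mem_iInf]
  intro N
  have h1 : f ∈ (sandwichPNegaRho p e P m m : Set O) :=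
    subset_sandwichPNegaRho p e P (m := m) (a := m) (d := 1) (by omega) (by omega) (by rw [one_mul]; exact hf)
  have h2 : f ∈ sandwichPNega p e P m (N * p ^ e + n * (p ^ e - 1) + m + 1) :=
    sandwichPNegaRho_subset p e P m _ (hmono _ (by omega) h1)
  exact sandwichPNega_le_pow_of_order p e u hP m (j := N) (by omega) h2

/-- **OBSTRUCTION, PW form** (res-type-087's power witness `PW(−a) = ρ^e(℘nega_sw(E,−a))`, `Campaign.PowerWitness.negPiece` p492701;
`O` reduced): under the same hypotheses `PW(−m) ⊄ PW(−b)` for some `b > m` — so the PW cell «F8⁻ ✓c (Lem5.9(1))» of 03:42:50Z has NO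
instance in the regime (its premise is `not_Lem5_9_1_frobeniusRange_of_krull`-refuted wherever `℘(E,m) ≠ 0`). [folklore] -/
theorem negPiece_not_le_of_krull [IsReduced O] (e : ℕ) {n : ℕ} (u : Fin n → O)
    (hKrull : ⨅ N : ℕ, Ideal.span (Set.range u) ^ N = ⊥)
    {P : ℕ → Ideal O} (hP : ∀ k, 0 < k → P k ≤ Ideal.span (Set.range u) ^ k)
    {m : ℕ} (hm : 0 < m) (hPm : P m ≠ ⊥) :
    ¬ ∀ b : ℕ, m < b → PowerWitness.negPiece p e P m m ≤ PowerWitness.negPiece p e P m b := by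
  intro hmono
  apply hPm
  rw [eq_bot_iff]
  intro f hf
  have hpow : f ^ p ^ e = 0 := by
    rw [← Ideal.mem_bot, ← hKrull, Submodule.mem_iInf]
    intro N
    have h1 : f ∈ sandwichPNega p e P m m :=
      le_sandwichPNega p e P (m := m) (a := m) (d := 1) (by omega) (by omega) (by rw [one_mul]; exact hf)
    obtain ⟨y, hy, hyf⟩ :=
      PowerWitness.mem_negPiece_iff.mp (hmono (N * p ^ e + n * (p ^ e - 1) + m + 1) (by omega)
        (PowerWitness.pow_mem_negPiece h1))
    rw [← hyf]
    exact Ideal.pow_mem_of_mem _ (sandwichPNega_le_pow_of_order p e u hP m (j := N) (by omega) hy) _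
      (pow_pos (Fact.out : p.Prime).pos e)
  exact (Ideal.mem_bot).mpr (IsNilpotent.eq_zero ⟨p ^ e, hpow⟩)

/-! ## §4 The Noetherian local placements (Krull supplied by Mathlib) -/

section Local

variable [IsNoetherianRing O] [IsLocalRing O]

omit [Fact p.Prime] [CharP O p] in
/-- A finite enumeration of generators of the maximal ideal, with Krull's `⋂_N 𝔪^N = 0`. [folklore] -/
theorem exists_generators_maximalIdeal :
    ∃ (n : ℕ) (u : Fin n → O), Ideal.span (Set.range u) = IsLocalRing.maximalIdeal O ∧
      ⨅ N : ℕ, Ideal.span (Set.range u) ^ N = ⊥ := by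
  classical
  obtain ⟨s, hs⟩ := (IsNoetherian.noetherian (IsLocalRing.maximalIdeal O) : (IsLocalRing.maximalIdeal O).FG)
  refine ⟨s.card, fun i => ((s.equivFin.symm i : ↥s) : O), ?_, ?_⟩
  all_goals
    have hrange : Set.range (fun i : Fin s.card => ((s.equivFin.symm i : ↥s) : O)) = (s : Set O) := by
      ext x
      constructor
      · rintro ⟨i, rfl⟩
        exact (s.equivFin.symm i).2
      · intro hx
        exact ⟨s.equivFin ⟨x, hx⟩, by simp⟩
  · rw [hrange]
    exact hs
  · rw [hrange, show Ideal.span (s : Set O) = IsLocalRing.maximalIdeal O from hs]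
    exact Ideal.iInf_pow_eq_bot_of_isLocalRing _ (IsLocalRing.maximalIdeal.isMaximal O).ne_top

/-- **SW at a Noetherian local placement of the regime** (`℘(E,k) ⊆ 𝔪^k`, `℘(E,m) ≠ 0`, `m ≥ 1`): `℘nega_sw(E,−m) ⊄ ℘nega_sw(E,−b)` for some
`b > m`; hence F8⁻ ✗ and Lem 5.9 (1) at base `ρ^e(O)` ✗ there. [folklore] -/
theorem sandwichPNega_not_le_of_isLocalRing (e : ℕ) {P : ℕ → Ideal O}
    (hP : ∀ k, 0 < k → P k ≤ IsLocalRing.maximalIdeal O ^ k) {m : ℕ} (hm : 0 < m) (hPm : P m ≠ ⊥) :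
    (¬ ∀ b : ℕ, m < b → sandwichPNega p e P m m ≤ sandwichPNega p e P m b) ∧
      ¬ S05NegativePart.Lem5_9_1 (↥(iterateFrobenius O p e).range) P m ∧
      ¬ ∀ i j : ℤ, i ≤ j → j ≤ 0 → sandwichPTildeNeg p e P m (-j) ≤ sandwichPTildeNeg p e P m (-i) := by
  obtain ⟨n, u, hu, hKrull⟩ := exists_generators_maximalIdeal (O := O)
  have hP' : ∀ k, 0 < k → P k ≤ Ideal.span (Set.range u) ^ k := fun k hk => hu ▸ hP k hk
  exact ⟨sandwichPNega_not_le_of_krull p e u hKrull hP' hm hPm,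
    not_Lem5_9_1_frobeniusRange_of_krull p e u hKrull hP' hm hPm,
    not_antitone_nonpos_sandwich_of_krull p e u hKrull hP' hm hPm⟩

/-- **SWρ and PW at a Noetherian local placement of the regime** (`O` reduced for PW): neither the module pieces nor the
power-witness pieces increase from degree `−m` to every lower degree. [folklore] -/
theorem sandwichPNegaRho_negPiece_not_subset_of_isLocalRing [IsReduced O] (e : ℕ) {P : ℕ → Ideal O}
    (hP : ∀ k, 0 < k → P k ≤ IsLocalRing.maximalIdeal O ^ k) {m : ℕ} (hm : 0 < m) (hPm : P m ≠ ⊥) :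
    (¬ ∀ b : ℕ, m < b → (sandwichPNegaRho p e P m m : Set O) ⊆ (sandwichPNegaRho p e P m b : Set O)) ∧
      ¬ ∀ b : ℕ, m < b → PowerWitness.negPiece p e P m m ≤ PowerWitness.negPiece p e P m b := by
  obtain ⟨n, u, hu, hKrull⟩ := exists_generators_maximalIdeal (O := O)
  have hP' : ∀ k, 0 < k → P k ≤ Ideal.span (Set.range u) ^ k := fun k hk => hu ▸ hP k hk
  exact ⟨sandwichPNegaRho_not_subset_of_krull p e u hKrull hP' hm hPm, negPiece_not_le_of_krull p e u hKrull hP' hm hPm⟩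

end Local

end Summit.ResolutionOfSingularities.ResolutionOfSingularities.Theorems.Campaign.W12

end
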